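import Summits.ValiantsHypothesis.ValiantsHypothesis.Theorems.GrenetZeonDualUnipotentThreeHalvesLongMassNilSpaceViolatorPortraitTwo
import Summits.ValiantsHypothesis.ValiantsHypothesis.Theorems.GrenetZeonDualUnipotentThreeHalvesLongMassNilSpaceJacobson
import Summits.ValiantsHypothesis.ValiantsHypothesis.Theorems.GrenetZeonDualUnipotentThreeHalvesLongMassNilSpaceKolchin
import Summits.ValiantsHypothesis.ValiantsHypothesis.Theorems.GrenetZeonDualUnipotentThreeHalvesLongMassNilSpaceLevitzki

/-!
# `GrenetZeon.DualUnipotentThreeHalves` (stmt-ValiantsHypothesis-24318), line `slow_core`, stub (c) `SlowCore.LongMassSlowLawInv`: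
# THE VIOLATOR PORTRAIT, THIRD PLATE — the SEMIGROUP lines (Jacobson · Jordan · Kolchin · Levitzki) from budget `2·⌊√n⌋·b`

Addendum to ✓ `…LongMassNilSpaceViolatorPortrait{,Two}` in the same submodule currency (an EXPENSIVE space: `dim V ≤ n²` and no window
certificate `(W, k)` of price `≤ P`, `P ≥ 2·⌊√n⌋·b`), using this hand's by-name criteria for the triangularisable locus:

* ★ `not_weaklyClosed_of_expensive_two` — JACOBSON LINE: a nil expensive space contains `A, B` whose whole line `AB + γ·BA` (`γ ∈ ℂ`) misses it
  (✓ `NilSpaceJacobson.exists_unit_conj_strictUpper_of_weaklyClosed`); in particular ★ `not_jordanClosed_of_expensive_two`: some anticommutator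
  `AB + BA` leaves `V`.
* ★ `exists_prod_not_unipotent_of_expensive_two` — KOLCHIN LINE: some finite product `(1 + X₁)⋯(1 + X_s)`, `X_t ∈ V`, is not unipotent
  (✓ `NilSpaceKolchin.conj_strictUpper_iff_monoid_unipotent`).
* ★ `exists_word_not_isNilpotent_of_expensive_two` — LEVITZKI LINE: some `V`-word of positive length is NOT nilpotent
  (✓ `NilSpaceLevitzki.conj_strictUpper_iff_words_isNilpotent`) — the cheapest wildness certificate to exhibit for a census row.
* ★★ `violator_portrait_three` — the conjunction of the four lines at every budget `P ≥ 2·⌊√n⌋·b`.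

HONEST FRAMING.  Checklist (`--supports stmt-ValiantsHypothesis-24318`); NOT progress on the research stub (c) `SlowCore.LongMassSlowLawInv`; closes no
stub; S3, 24318, 8062 and `VP ≠ VNP` are NOT proved.  Def-free, no named-fact hypotheses, no sorry.
[cite: Jacobson1962LieAlgebras, Ch. II §2 Thm. 1] [cite: RadjaviRosenthal2000, Thm. 2.1.7–2.1.8, p0035]
-/

set_option linter.dupNamespace false
set_option autoImplicit false

noncomputable section

namespace Summit.ValiantsHypothesis.ValiantsHypothesis.Theorems.GrenetZeon.NilSpaceViolatorPortrait

open MvPolynomial Matrix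
open scoped BigOperators
open Summit.ValiantsHypothesis.ValiantsHypothesis.Theorems.GrenetZeon.NilSpaceJacobson
  (exists_unit_conj_strictUpper_of_weaklyClosed exists_unit_conj_strictUpper_of_jordanClosed)
open Summit.ValiantsHypothesis.ValiantsHypothesis.Theorems.GrenetZeon.NilSpaceKolchin (conj_strictUpper_iff_monoid_unipotent)
open Summit.ValiantsHypothesis.ValiantsHypothesis.Theorems.GrenetZeon.NilSpaceLevitzki (conj_strictUpper_iff_words_isNilpotent)

variable {b : ℕ}

/-- ★ **JACOBSON LINE** (nil `V`, budget `≥ 2⌊√n⌋b`): an expensive nil space is not weakly closed — some pair `A, B ∈ V` has `AB + γ·BA ∉ V`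
for EVERY scalar `γ`. [cite: Jacobson1962LieAlgebras, Ch. II §2 Thm. 1] -/
theorem not_weaklyClosed_of_expensive_two (V : Submodule ℂ (Matrix (Fin b) (Fin b) ℂ)) (hnil : ∀ A ∈ V, IsNilpotent A) (n P : ℕ)
    (hV : Module.finrank ℂ V ≤ n * n) (hP : 2 * (Nat.sqrt n * b) ≤ P)
    (hexp : ∀ (W : Submodule ℂ (Matrix (Fin b) (Fin b) ℂ)) (k : ℕ), W ≤ V →
      (∀ A ∈ V, ∀ w ∈ W, ∀ p : ℕ, p ≤ n - 1 → ∀ i j : Fin b,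
        ((((A.map (C : ℂ → MvPolynomial (Fin 1) ℂ) + (X 0 : MvPolynomial (Fin 1) ℂ) • w.map C) ^ p :
          Matrix (Fin b) (Fin b) (MvPolynomial (Fin 1) ℂ)) i j).totalDegree ≤ k)) →
      P < n * k + (Module.finrank ℂ V - Module.finrank ℂ W)) :
    ∃ A ∈ V, ∃ B ∈ V, ∀ γ : ℂ, A * B + γ • (B * A) ∉ V := by
  by_contra hcon
  push Not at hcon
  exact not_triangularisable_of_expensive_two V n P hV hP hexp
    (exists_unit_conj_strictUpper_of_weaklyClosed V hnil fun A hA B hB => hcon A hA B hB)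

/-- ★ **JORDAN LINE** (nil `V`, budget `≥ 2⌊√n⌋b`): some anticommutator `AB + BA` leaves `V`. [cite: Jacobson1962LieAlgebras, Ch. II §2 Thm. 1] -/
theorem not_jordanClosed_of_expensive_two (V : Submodule ℂ (Matrix (Fin b) (Fin b) ℂ)) (hnil : ∀ A ∈ V, IsNilpotent A) (n P : ℕ)
    (hV : Module.finrank ℂ V ≤ n * n) (hP : 2 * (Nat.sqrt n * b) ≤ P)
    (hexp : ∀ (W : Submodule ℂ (Matrix (Fin b) (Fin b) ℂ)) (k : ℕ), W ≤ V →
      (∀ A ∈ V, ∀ w ∈ W, ∀ p : ℕ, p ≤ n - 1 → ∀ i j : Fin b,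
        ((((A.map (C : ℂ → MvPolynomial (Fin 1) ℂ) + (X 0 : MvPolynomial (Fin 1) ℂ) • w.map C) ^ p :
          Matrix (Fin b) (Fin b) (MvPolynomial (Fin 1) ℂ)) i j).totalDegree ≤ k)) →
      P < n * k + (Module.finrank ℂ V - Module.finrank ℂ W)) :
    ∃ A ∈ V, ∃ B ∈ V, A * B + B * A ∉ V := by
  by_contra hcon
  push Not at hcon
  exact not_triangularisable_of_expensive_two V n P hV hP hexp (exists_unit_conj_strictUpper_of_jordanClosed V hnil hcon)

/-- ★ **KOLCHIN LINE** (budget `≥ 2⌊√n⌋b`): some finite product of members of `1 + V` is not unipotent.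
[cite: RadjaviRosenthal2000, Thm. 2.1.8 (Kolchin's Theorem), p0035] -/
theorem exists_prod_not_unipotent_of_expensive_two (V : Submodule ℂ (Matrix (Fin b) (Fin b) ℂ)) (n P : ℕ)
    (hV : Module.finrank ℂ V ≤ n * n) (hP : 2 * (Nat.sqrt n * b) ≤ P)
    (hexp : ∀ (W : Submodule ℂ (Matrix (Fin b) (Fin b) ℂ)) (k : ℕ), W ≤ V →
      (∀ A ∈ V, ∀ w ∈ W, ∀ p : ℕ, p ≤ n - 1 → ∀ i j : Fin b,
        ((((A.map (C : ℂ → MvPolynomial (Fin 1) ℂ) + (X 0 : MvPolynomial (Fin 1) ℂ) • w.map C) ^ p :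
          Matrix (Fin b) (Fin b) (MvPolynomial (Fin 1) ℂ)) i j).totalDegree ≤ k)) →
      P < n * k + (Module.finrank ℂ V - Module.finrank ℂ W)) :
    ∃ (s : ℕ) (w : Fin s → Matrix (Fin b) (Fin b) ℂ), (∀ t, w t ∈ V) ∧
      ¬ IsNilpotent ((List.ofFn fun t => (1 : Matrix (Fin b) (Fin b) ℂ) + w t).prod - 1) := by
  by_contra hcon
  push Not at hcon
  exact not_triangularisable_of_expensive_two V n P hV hP hexp
    ((conj_strictUpper_iff_monoid_unipotent V).mpr fun s w hw => hcon s w hw)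

/-- ★ **LEVITZKI LINE** (budget `≥ 2⌊√n⌋b`): some `V`-word of positive length is not nilpotent.
[cite: RadjaviRosenthal2000, Thm. 2.1.7 (Levitzki's Theorem), p0035] -/
theorem exists_word_not_isNilpotent_of_expensive_two (V : Submodule ℂ (Matrix (Fin b) (Fin b) ℂ)) (n P : ℕ)
    (hV : Module.finrank ℂ V ≤ n * n) (hP : 2 * (Nat.sqrt n * b) ≤ P)
    (hexp : ∀ (W : Submodule ℂ (Matrix (Fin b) (Fin b) ℂ)) (k : ℕ), W ≤ V →
      (∀ A ∈ V, ∀ w ∈ W, ∀ p : ℕ, p ≤ n - 1 → ∀ i j : Fin b,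
        ((((A.map (C : ℂ → MvPolynomial (Fin 1) ℂ) + (X 0 : MvPolynomial (Fin 1) ℂ) • w.map C) ^ p :
          Matrix (Fin b) (Fin b) (MvPolynomial (Fin 1) ℂ)) i j).totalDegree ≤ k)) →
      P < n * k + (Module.finrank ℂ V - Module.finrank ℂ W)) :
    ∃ (s : ℕ) (w : Fin (s + 1) → Matrix (Fin b) (Fin b) ℂ), (∀ t, w t ∈ V) ∧ ¬ IsNilpotent ((List.ofFn w).prod) := by
  by_contra hcon
  push Not at hcon
  exact not_triangularisable_of_expensive_two V n P hV hP hexp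
    ((conj_strictUpper_iff_words_isNilpotent V).mpr fun s w hw => hcon s w hw)

/-- ★★ **THE VIOLATOR PORTRAIT, THIRD PLATE** (nil `V`, `dim V ≤ n²`, expensive at budget `P ≥ 2⌊√n⌋b`): the Jacobson, Jordan, Kolchin and
Levitzki lines hold simultaneously. [cite: Jacobson1962LieAlgebras, Ch. II §2 Thm. 1] [cite: RadjaviRosenthal2000, Thm. 2.1.7–2.1.8, p0035] -/
theorem violator_portrait_three (V : Submodule ℂ (Matrix (Fin b) (Fin b) ℂ)) (hnil : ∀ A ∈ V, IsNilpotent A) (n P : ℕ)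
    (hV : Module.finrank ℂ V ≤ n * n) (hP : 2 * (Nat.sqrt n * b) ≤ P)
    (hexp : ∀ (W : Submodule ℂ (Matrix (Fin b) (Fin b) ℂ)) (k : ℕ), W ≤ V →
      (∀ A ∈ V, ∀ w ∈ W, ∀ p : ℕ, p ≤ n - 1 → ∀ i j : Fin b,
        ((((A.map (C : ℂ → MvPolynomial (Fin 1) ℂ) + (X 0 : MvPolynomial (Fin 1) ℂ) • w.map C) ^ p :
          Matrix (Fin b) (Fin b) (MvPolynomial (Fin 1) ℂ)) i j).totalDegree ≤ k)) →
      P < n * k + (Module.finrank ℂ V - Module.finrank ℂ W)) :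
    (∃ A ∈ V, ∃ B ∈ V, ∀ γ : ℂ, A * B + γ • (B * A) ∉ V) ∧
    (∃ A ∈ V, ∃ B ∈ V, A * B + B * A ∉ V) ∧
    (∃ (s : ℕ) (w : Fin s → Matrix (Fin b) (Fin b) ℂ), (∀ t, w t ∈ V) ∧
      ¬ IsNilpotent ((List.ofFn fun t => (1 : Matrix (Fin b) (Fin b) ℂ) + w t).prod - 1)) ∧
    (∃ (s : ℕ) (w : Fin (s + 1) → Matrix (Fin b) (Fin b) ℂ), (∀ t, w t ∈ V) ∧ ¬ IsNilpotent ((List.ofFn w).prod)) :=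
  ⟨not_weaklyClosed_of_expensive_two V hnil n P hV hP hexp, not_jordanClosed_of_expensive_two V hnil n P hV hP hexp,
    exists_prod_not_unipotent_of_expensive_two V n P hV hP hexp, exists_word_not_isNilpotent_of_expensive_two V n P hV hP hexp⟩

end Summit.ValiantsHypothesis.ValiantsHypothesis.Theorems.GrenetZeon.NilSpaceViolatorPortrait

end
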